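import Mathlib
import HarnessLib

/-!
# Tropical cycles on tropical tori: framed simplicial cycles, the cycle class, and the Weil functional

Coordinate-bound, finite-dimensional definitions of the objects of Kontsevich's tropical test for the
Hodge conjecture on tropical abelian varieties (Mikhalkin–Zharkov 2014; Zharkov 2020), in the generality
of a tropical torus `X_Q = ℝᵍ / Q·ℤᵍ` with slope lattice `Γ₂ = ℤᵍ` and period lattice `Γ₁ = Q·ℤᵍ`
(`Q` a real `g × g` matrix; for a principally polarised tropical abelian variety `Q` is symmetric
positive definite, Mikhalkin–Zharkov Def. 6.1, Zharkov p. 1).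

* `TropicalCell g p` — a weighted framed lattice `p`-simplex in `ℝᵍ`: a positive integer weight `w`,
  vertices `v₀, …, v_p`, an integer `g × p` matrix `L` whose columns are a *saturated* basis
  `l₁, …, l_p` of `L_σ ∩ ℤᵍ` (`L_σ` the direction space; saturation = a left inverse over `ℤ`), and a
  real `p × p` matrix `T` of positive determinant with edge vectors `v_j - v₀ = Σ_m l_m T_{m j}`.
  So the simplex is `Γ₂`-rational of dimension `p`, oriented by `(v₀, …, v_p)`, its frame
  `vol_σ = l₁ ∧ … ∧ l_p ∈ ⋀ᵖ ℤᵍ` is the generator inducing that orientation, and its lattice volume is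
  `a_σ = det T / p!` (Mikhalkin–Zharkov Def. 4.2 / Prop. 4.3: "`ω_k = w_k vol_{σ_k}`").
* `TropicalTorusCycle g p Q` — an **effective tropical `p`-cycle on `X_Q`** presented as a finite family
  of cells together with a CLOSEDNESS CERTIFICATE: the `(p+1)·#cells` facet slots `(σ, i)` (the facet
  of `σ` opposite to `vᵢ`, incidence sign `(-1)ⁱ`) are grouped into classes; all facets of one class are
  `Q·ℤᵍ`-translates of a common reference ordered `(p-1)`-simplex up to a recorded re-ordering `π`
  of its vertices (orientation sign `sign π`); and in every class the signed sum of the frames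
  `Σ (-1)ⁱ · sign π · w_σ · vol_σ` vanishes in `⋀ᵖ ℤᵍ` (all Plücker coordinates zero). This is the
  cycle condition `∂c = 0` of the polyhedral chain complex with coefficients `⋀ᵖ Γ₂` modulo
  `Γ₁`-translation (Mikhalkin–Zharkov §4; "closed ⟺ balanced", Prop. 4.3 / Def. 4.2), written
  facet-class by facet-class: it implies `∂c = 0`, and conversely every tropical `p`-cycle (balanced
  weighted rational polyhedral complex in `X_Q`) is represented in this format after a face-to-face
  simplicial refinement, with the facet classes = the `(p-1)`-cells of the complex. Statements
  quantifying over ALL `TropicalTorusCycle`s are therefore statements about all effective tropical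
  `p`-cycles at the level of cycle classes.
* `TropicalTorusCycle.cyc Z : (Fin p → Fin g) → (Fin p → Fin g) → ℝ` — the **cycle class**
  `[Z] = Σ_σ w_σ a_σ vol_σ ⊗ vol_σ ∈ ⋀ᵖ ℝᵍ ⊗ ⋀ᵖ ℤᵍ` (Mikhalkin–Zharkov Prop. 4.3; Zharkov p. 1
  "`vol(Z)`") in Plücker coordinates: `cyc Z S S' = Σ_σ w_σ (det T_σ / p!) · det L_σ[S] · det L_σ[S']`
  (the row selections `S, S'` range over all maps `Fin p → Fin g`; the values on non-injective or
  permuted selections are the alternating extension, which changes neither spans nor linear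
  (in)dependence).
* The Weil family (`g = 2n`, `p = n`; Zharkov §2 for `n = 2`): `weilJ n` is the complex structure
  `J e_k = e_{k+n}`, `J e_{k+n} = -e_k` on `ℤ²ⁿ = ℤ[i]ⁿ` (complex coordinates `z_k = x_k + i x_{k+n}`);
  `frameComplexDet n L = det_ℂ [ (l_j)_k + i (l_j)_{k+n} ]_{k,j} = (dz₁ ∧ … ∧ dz_n)(l₁, …, l_n)`;
  `weilFunctional Z = Σ_σ w_σ a_σ η_σ²`, `η_σ = frameComplexDet n L_σ` — the value on `[Z]` of the
  linear functional `x ⊗ y ↦ dz(x) · dz(y)` on `⋀ⁿ ℝ²ⁿ ⊗ ⋀ⁿ ℤ²ⁿ` (`dz(a_σ vol_σ) = a_σ η_σ` by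
  Cauchy–Binet), which vanishes on the theta class `θ_n(Q)` and not on Zharkov's tropical Weil
  classes `(⋀ⁿQ ⊗ 1)(Ω ⊗ Ω)`, `Ω = ⋀_k (e_k - i e_{k+n})`, when `QJ = JQ`, `Q ≻ 0`;
  `IsWeilGeneric n Q` — the `n(n+1)/2 + n(n-1)/2 = n²` free real coordinates of a `J`-commuting
  symmetric `Q = [[A, B], [-B, A]]` are algebraically independent over `ℚ` ("very general parameter").

## Design choices

Everything is stated over `Fin`-indexed real/integer matrices and Mathlib's `Matrix.det`,
`Equiv.Perm.sign`, `AlgebraicIndependent`; no polyhedral chain complex, no tropical homology, no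
eigenwave and no intersection pairing is constructed here (consumers that need "cycle classes are
tropical Hodge classes", Mikhalkin–Zharkov Thm. 5.4, or the rationality `[Z] ∈ ⋀ᵖΓ₁ ⊗ ⋀ᵖΓ₂`, state them
about `cyc`). Weights are positive naturals (effective cycles); a cycle may have no cells (the zero
cycle). The certificate fields are data, so two terms may present the same cycle; all consumers speak
about `cyc` and `weilFunctional`, which depend only on the cells.

## What is NOT here

Tropical cycles on general tropical manifolds, sedentarity, the eigenwave `φ`, tropical homology
groups, the tropical intersection product, formal (parameter-dependent) cycles.

## References

* G. Mikhalkin, I. Zharkov, *Tropical eigenwave and intermediate Jacobians*, in: Homological Mirror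
  Symmetry and Tropical Geometry, LN UMI 15 (2014), Def. 4.2, Prop. 4.3, §5.1, Thm. 5.4, Def. 6.1
  (arXiv:1302.0252).
* I. Zharkov, *Tropical abelian varieties, Weil classes and the Hodge conjecture*, arXiv:2002.02347
  (2020), pp. 1–4.
-/

noncomputable section

open scoped BigOperators

namespace Literature.AlgebraicGeometry.Tropical

/-- The **Plücker coordinate** of the columns `l₁, …, l_p` of an integer `g × p` matrix `L` at a row
selection `S : Fin p → Fin g`: the `p × p` minor `det (L_{S(a), b})_{a,b}`, i.e. the coordinate of
`l₁ ∧ … ∧ l_p ∈ ⋀ᵖ ℤᵍ` on `e_{S(0)} ∧ … ∧ e_{S(p-1)}` (alternating in `S`). [folklore] -/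
def pluckerCoord {g p : ℕ} (L : Matrix (Fin g) (Fin p) ℤ) (S : Fin p → Fin g) : ℤ :=
  (L.submatrix S id).det

/-- A **weighted framed lattice `p`-simplex in `ℝᵍ`** (a cell of an effective tropical `p`-chain on a
tropical torus with slope lattice `ℤᵍ`): weight `w ∈ ℕ`, `w > 0`; vertices `v₀, …, v_p ∈ ℝᵍ`; an
integer `g × p` matrix `frame = (l₁ | … | l_p)` admitting a left inverse over `ℤ` (its columns are a
basis of a saturated rank-`p` sublattice `L_σ ∩ ℤᵍ`); and a real `p × p` matrix `edgeCoeff = T` with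
`det T > 0` and `v_j - v₀ = Σ_m l_m T_{m j}` (so the simplex is non-degenerate, spans the rational
`p`-space `L_σ = ⟨l₁, …, l_p⟩_ℝ`, and `l₁ ∧ … ∧ l_p` is the generator `vol_σ` of `⋀ᵖ(L_σ ∩ ℤᵍ)` inducing
the orientation of `(v₀, …, v_p)`; the lattice volume is `a_σ = det T / p!`).
[cite: MikhalkinZharkov2014Eigenwave, Def. 4.2 and Prop. 4.3] -/
structure TropicalCell (g p : ℕ) where
  /-- the weight `w_σ` -/
  weight : ℕ
  /-- effective: `w_σ > 0` -/
  weight_pos : 0 < weight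
  /-- the vertices `v₀, …, v_p` -/
  vertex : Fin (p + 1) → Fin g → ℝ
  /-- a saturated lattice basis `l₁, …, l_p` of the direction lattice, as columns -/
  frame : Matrix (Fin g) (Fin p) ℤ
  /-- the edge vectors in the lattice basis: `v_j - v₀ = Σ_m l_m T_{m j}` -/
  edgeCoeff : Matrix (Fin p) (Fin p) ℝ
  /-- the edges lie in `L_σ` with coefficients `T` -/
  vertex_succ_sub : ∀ (j : Fin p) (a : Fin g),
    vertex j.succ a - vertex 0 a = ∑ m, (frame a m : ℝ) * edgeCoeff m j
  /-- non-degenerate and oriented like the frame -/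
  edgeCoeff_det_pos : 0 < edgeCoeff.det
  /-- the frame is saturated (extends to a basis of `ℤᵍ`) -/
  frame_saturated : ∃ M : Matrix (Fin p) (Fin g) ℤ, M * frame = 1

namespace TropicalCell

variable {g p : ℕ}

/-- The lattice-normalised volume `a_σ = det T / p!` of a cell, defined by `σ⃗ = a_σ · vol_σ` where
`σ⃗ = (1/p!) (v₁ - v₀) ∧ … ∧ (v_p - v₀)` is the `p`-vector of the simplex.
[cite: MikhalkinZharkov2014Eigenwave, Prop. 4.3] -/
def latticeVolume (c : TropicalCell g p) : ℝ :=
  c.edgeCoeff.det / (p.factorial : ℝ)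

end TropicalCell

/-- An **effective tropical `p`-cycle on the tropical torus `X_Q = ℝᵍ / Q·ℤᵍ`** (slope lattice `ℤᵍ`,
period lattice `Q·ℤᵍ`), presented as finitely many weighted framed lattice simplices together with a
closedness certificate: every facet slot `(σ, i)` (facet of cell `σ` opposite to its `i`-th vertex,
incidence sign `(-1)ⁱ`) is assigned a facet class `facetClass σ i`, a re-ordering `facetPerm σ i` and a
lattice shift `facetShift σ i ∈ ℤᵍ` such that the re-ordered facet is the `Q·(facetShift σ i)`-translate
of the reference ordered `(p-1)`-simplex of its class (`facet_eq`), and in each class the signed frames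
cancel: `Σ_{(σ,i) ∈ class} (-1)ⁱ · sign(facetPerm σ i) · w_σ · vol_σ = 0` in `⋀ᵖ ℤᵍ` (`balanced`, one
equation per Plücker coordinate). This is the cycle condition `∂(Σ_σ [σ] ⊗ w_σ vol_σ) = 0` in the
polyhedral chain complex of the torus with coefficients `⋀ᵖ ℤᵍ` ("closed ⟺ balanced"); every balanced
weighted rational polyhedral complex in `X_Q` is so presented after a face-to-face simplicial
refinement. [cite: MikhalkinZharkov2014Eigenwave, Def. 4.2, Prop. 4.3 and Def. 6.1] -/
structure TropicalTorusCycle (g p : ℕ) (Q : Matrix (Fin g) (Fin g) ℝ) where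
  /-- number of cells -/
  numCells : ℕ
  /-- the cells -/
  cell : Fin numCells → TropicalCell g p
  /-- number of facet classes -/
  numFacetClasses : ℕ
  /-- the reference ordered `(p-1)`-simplex (`p` vertices) of each facet class -/
  refFacet : Fin numFacetClasses → Fin p → Fin g → ℝ
  /-- the class of the facet of `σ` opposite to vertex `i` -/
  facetClass : Fin numCells → Fin (p + 1) → Fin numFacetClasses
  /-- the re-ordering matching that facet with the reference simplex of its class -/
  facetPerm : Fin numCells → Fin (p + 1) → Equiv.Perm (Fin p)
  /-- the period-lattice shift matching that facet with the reference simplex of its class -/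
  facetShift : Fin numCells → Fin (p + 1) → Fin g → ℤ
  /-- vertex `π j` of the facet `(σ, i)` is vertex `j` of the reference simplex translated by
  `Q · facetShift σ i` -/
  facet_eq : ∀ (σ : Fin numCells) (i : Fin (p + 1)) (j : Fin p) (a : Fin g),
    (cell σ).vertex (i.succAbove (facetPerm σ i j)) a =
      refFacet (facetClass σ i) j a + ∑ b, Q a b * (facetShift σ i b : ℝ)
  /-- in every facet class the signed weighted frames cancel in `⋀ᵖ ℤᵍ` -/
  balanced : ∀ (f : Fin numFacetClasses) (S : Fin p → Fin g),
    (∑ σ, ∑ i : Fin (p + 1),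
      if facetClass σ i = f then
        ((cell σ).weight : ℤ) * (-1) ^ (i : ℕ) * ((Equiv.Perm.sign (facetPerm σ i) : ℤˣ) : ℤ) *
          pluckerCoord (cell σ).frame S
      else 0) = 0

namespace TropicalTorusCycle

variable {g p : ℕ} {Q : Matrix (Fin g) (Fin g) ℝ}

/-- The **cycle class** `[Z] = Σ_σ w_σ σ⃗ ⊗ vol_σ = Σ_σ w_σ a_σ vol_σ ⊗ vol_σ ∈ ⋀ᵖ ℝᵍ ⊗ ⋀ᵖ ℤᵍ`
of an effective tropical `p`-cycle, in Plücker coordinates: `cyc Z S S' = Σ_σ w_σ · a_σ · det L_σ[S] ·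
det L_σ[S']` for row selections `S, S' : Fin p → Fin g` (both factors are Plücker coordinates of the
frame because the edge matrix is `L_σ T_σ`). For a closed chain this is the image of its tropical
homology class under `H_p(X; ⋀ᵖΓ₂) = ⋀ᵖΓ₁ ⊗ ⋀ᵖΓ₂ ⊂ ⋀ᵖℝᵍ ⊗ ⋀ᵖℝᵍ`.
[cite: MikhalkinZharkov2014Eigenwave, Prop. 4.3] -/
def cyc (Z : TropicalTorusCycle g p Q) : (Fin p → Fin g) → (Fin p → Fin g) → ℝ :=
  fun S S' => ∑ σ, ((Z.cell σ).weight : ℝ) * (Z.cell σ).latticeVolume *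
    ((pluckerCoord (Z.cell σ).frame S : ℤ) : ℝ) * ((pluckerCoord (Z.cell σ).frame S' : ℤ) : ℝ)

end TropicalTorusCycle

/-! ### The Weil family: `g = 2n`, `p = n`, complex structure `J`, the Weil functional -/

/-- The integral complex structure `J` on `ℤ²ⁿ = ℤ[i]ⁿ`: `J e_k = e_{k+n}`, `J e_{k+n} = -e_k`
(`k < n`), as a real `2n × 2n` matrix acting on column vectors; multiplication by `i` in the complex
coordinates `z_k = x_k + i·x_{k+n}`. A symmetric positive definite `Q` with `QJ = JQ`, i.e.
`Q = [[A, B], [-B, A]]`, gives the principally polarised tropical abelian variety `ℝ²ⁿ / Q·ℤ²ⁿ` with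
multiplication by `ℤ[i]` (Zharkov's tropical Weil tori, `n = 2`).
[cite: Zharkov2020TropicalWeil, §2 (pp. 2–4)] -/
def weilJ (n : ℕ) : Matrix (Fin (2 * n)) (Fin (2 * n)) ℝ :=
  fun a b => if (a : ℕ) = b + n then 1 else if (b : ℕ) = a + n then -1 else 0

/-- `η(L) = (dz₁ ∧ … ∧ dz_n)(l₁, …, l_n) = det_ℂ [ (l_j)_k + i·(l_j)_{k+n} ]_{k,j} ∈ ℤ[i]` for an
integer `2n × n` matrix `L = (l₁ | … | l_n)`, `z_k = x_k + i·x_{k+n}`: the `dz`-component of the frame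
`l₁ ∧ … ∧ l_n`; non-zero exactly when `L ⊕ J L` spans `ℝ²ⁿ` ("totally real" frames).
[cite: Zharkov2020TropicalWeil, §2 (pp. 2–4)] -/
def frameComplexDet (n : ℕ) (L : Matrix (Fin (2 * n)) (Fin n) ℤ) : ℂ :=
  (Matrix.of fun k j : Fin n =>
    ((L ⟨(k : ℕ), by omega⟩ j : ℤ) : ℂ) + ((L ⟨(k : ℕ) + n, by omega⟩ j : ℤ) : ℂ) * Complex.I).det

/-- The **Weil functional** of an effective tropical `n`-cycle `Z` on `ℝ²ⁿ / Q·ℤ²ⁿ`: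
`W(Z) = Σ_σ w_σ · a_σ · η_σ² ∈ ℂ`, `η_σ = frameComplexDet n L_σ`, i.e. the value on the cycle class
`[Z] = Σ_σ w_σ a_σ vol_σ ⊗ vol_σ` of the linear functional `x ⊗ y ↦ dz(x)·dz(y)`,
`dz = dz₁ ∧ … ∧ dz_n` (by Cauchy–Binet `dz(vol_σ) = η_σ`). For `QJ = JQ` it vanishes on the theta
class `θ_n(Q) = Σ_I Qe_I ⊗ e_I` and takes the values `2ⁿ det_ℂ(Q|_{V^{1,0}}) · 2ⁿ ≠ 0`, resp. `0`, on
Zharkov's Weil classes `(⋀ⁿQ ⊗ 1)(Ω ⊗ Ω)` and its conjugate, `Ω = ⋀_k (e_k - i e_{k+n})`; so `W`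
separates the real tropical Weil classes `Re`, `Im` of `(⋀ⁿQ ⊗ 1)(Ω ⊗ Ω)` from `θ_n(Q)`.
[cite: Zharkov2020TropicalWeil, §2 (pp. 2–4)] -/
def weilFunctional {n : ℕ} {Q : Matrix (Fin (2 * n)) (Fin (2 * n)) ℝ}
    (Z : TropicalTorusCycle (2 * n) n Q) : ℂ :=
  ∑ σ, ((Z.cell σ).weight : ℂ) * ((Z.cell σ).latticeVolume : ℂ) *
    frameComplexDet n (Z.cell σ).frame ^ 2

/-- The index set of the `n²` free real coordinates of a symmetric `J`-commuting `2n × 2n` matrix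
`Q = [[A, B], [-B, A]]` (`A` symmetric, `B` antisymmetric): the entries `(a, b)` with `a ≤ b < n`
(upper triangle of `A`, diagonal included) or `a < n`, `a + n < b` (strict upper triangle of `B`).
[cite: Zharkov2020TropicalWeil, §2 (pp. 2–4)] -/
def weilFreeIndex (n : ℕ) : Type :=
  {ab : Fin (2 * n) × Fin (2 * n) //
    (ab.1 : ℕ) ≤ ab.2 ∧ ((ab.2 : ℕ) < n ∨ ((ab.1 : ℕ) < n ∧ (ab.1 : ℕ) + n < ab.2))}

/-- **Very general parameter** of the tropical Weil family: the `n²` free coordinates of `Q`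
(`weilFreeIndex n`) are algebraically independent over `ℚ`. For such `Q` (symmetric, `QJ = JQ`) every
polynomial identity with rational coefficients satisfied by the entries of `Q` holds identically on
the family — the tropical counterpart of "very general fibre".
[cite: Zharkov2020TropicalWeil, §2 (pp. 2–4)] -/
def IsWeilGeneric (n : ℕ) (Q : Matrix (Fin (2 * n)) (Fin (2 * n)) ℝ) : Prop :=
  AlgebraicIndependent ℚ fun ab : weilFreeIndex n => Q ab.1.1 ab.1.2

end Literature.AlgebraicGeometry.Tropical

end
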